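import Literature.Probability.RandomPlanarGeometry.SAWTriangularBridges
import Literature.Probability.RandomPlanarGeometry.SAWUnfolding
import HarnessLib

/-!
# The Hammersley–Welsh unfolding on the triangular lattice: `h_n(𝕋) ≤ e^{3√(2n)} b_n(𝕋)`

Topic `Literature/Probability/RandomPlanarGeometry` (continues `SAWTriangularBridges.lean`). Source:
N. Madras, G. Slade, *The Self-Avoiding Walk* (1993), §3.1, proof of Proposition 3.1.5 ("Given an
`N`-step half-space walk `ω`, define a new `N`-step walk `ω'` … the reflection of the point `ω(i)` in
the hyperplane `x₁ = A₁(ω)`", "this transformation is one-to-one", "`h_N ≤ Σ_A P_D(A) b_{N,A} ≤ P_D(N) b_N`")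
— there for `ℤ^d`; for a graph with a unimodular graph height function the same unfolding is
Grimmett–Li's [cite: GrimmettLi2018Locality, §7 (proof of the Proposition: unfolding of half-space walks)].

Everything graph-free is the TREE's: the step `Zd.unfoldStep n ω` (reflection `Zd.reflCoord` of
coordinate `0` beyond the last maximum `Zd.lastArgmax`), its inverse `Zd.undoStep`, the increments
`Zd.increment/Zd.incr`, the levels `Zd.level`, `Zd.increment_unfoldStep_lt` ("`A₁ > A₂ > ⋯`"), the
sequence lemma `Zd.eq_of_antitone_of_image_eq`, and the code count `card_finsetsOfSumLE_le_exp`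
(`#{sets of positive integers with sum ≤ m} ≤ e^{3√m}`). What changes on `𝕋` (brick coordinates, height
= coordinate `0`, steps of height `1` or `2`): the maximal height of an `n`-step walk is `≤ 2n`, so the
unfolding needs `2n + 1` iterations and the code has sum `≤ 2n`; and membership in `brickSaws n` is
re-proved (`brickGraph` is invariant under `Zd.reflCoord`, `brickGraph_adj_reflCoord`).

## Contents (namespace `Literature.Probability.RandomPlanarGeometry.SAW`, all PROVED)

* `unfoldStep_mem_brickSaws`, `unfoldStep_eq_self_iff_brick`, `iterate_unfoldStep_mem_brickSaws`,
  `maxLevel_mem_Icc_brick` (`0 ≤ A₁ ≤ 2n`), `incr_succ_lt_brick`, `incr_succ_le_brick`;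
* `brickUnfold n ω = (unfoldStep n)^[2n+1] ω`: `unfoldStep_brickUnfold` (a fixed point),
  `brickUnfold_mem_brickSaws`, `apply_le_brickUnfold_last`, **`brickUnfold_mem_brickBridges`**
  (half-space walks are unfolded into bridges);
* `brickCode n ω` (positive increments over `2n+1` steps): `brickCode_mem_finsetsOfSumLE` (sum `≤ 2n`),
  `incr_eq_of_brickCode_eq`, **`brickUnfold_code_injOn`** (`ω ↦ (unfold ω, code ω)` is injective);
* `card_le_exp_mul_card_image_brickUnfold` (`#T ≤ e^{3√(2n)} #(unfold '' T)`) and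
  **`brickHalfSpaceCount_le_exp_mul_brickBridgeCount : h_n(𝕋) ≤ e^{3√(2n)} b_n(𝕋)`**.
-/

noncomputable section

open Finset Function Literature.Probability.LatticeModels Literature.Probability.Percolation SimpleGraph
open Literature.Combinatorics.Enumerative

namespace Literature.Probability.RandomPlanarGeometry.SAW

open Zd

/-! ### The step on the brick model -/

/-- **The unfolding step maps `n`-step self-avoiding walks of `𝕋` to `n`-step self-avoiding walks of
`𝕋`** (the reflection of the height is an automorphism of the brick-wall graph; the two pieces are
separated by the line `X = A₁`). [cite: MadrasSlade1993, §3.1 (proof of Proposition 3.1.5)] -/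
theorem unfoldStep_mem_brickSaws {n : ℕ} {ω : ℕ → Site 2} (hω : ω ∈ brickSaws n) :
    unfoldStep n ω ∈ brickSaws n := by
  obtain ⟨h0, hend, hadj, hinj⟩ := mem_brickSaws.1 hω
  set p := lastArgmax n ω with hp
  set ℓ := maxLevel n ω with hℓ
  obtain ⟨hpn, hpmax⟩ := lastArgmax_spec n ω
  rw [← hp, ← hℓ] at hpmax
  have hfix : reflCoord ℓ (ω p) = ω p := (reflCoord_eq_self_iff ℓ (ω p)).2 hpmax
  rw [mem_brickSaws]
  refine ⟨by rw [unfoldStep_zero, h0], fun i hi => ?_, fun i hi => ?_, fun i hi j hj hij => ?_⟩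
  · -- frozen after `n`
    rcases (hp ▸ hpn : p ≤ n).eq_or_lt with hpn' | hpn'
    · rcases hi.eq_or_lt with rfl | hin
      · rfl
      · rw [unfoldStep, ← hp, ← hℓ, reflectFrom_of_lt ω (by omega), reflectFrom_of_le ω (by omega),
          hend i hi, ← hpn', hfix]
    · rw [unfoldStep, ← hp, ← hℓ, reflectFrom_of_lt ω (by omega), reflectFrom_of_lt ω hpn', hend i hi]
  · -- brick steps
    by_cases h1 : i + 1 ≤ p
    · rw [unfoldStep, ← hp, ← hℓ, reflectFrom_of_le ω (by omega), reflectFrom_of_le ω h1]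
      exact hadj i hi
    · by_cases h2 : i ≤ p
      · have hip : i = p := by omega
        rw [unfoldStep, ← hp, ← hℓ, reflectFrom_of_le ω h2, reflectFrom_of_lt ω (by omega), hip,
          ← hfix]
        exact brickGraph_adj_reflCoord ℓ (hip ▸ hadj i hi)
      · rw [unfoldStep, ← hp, ← hℓ, reflectFrom_of_lt ω (by omega), reflectFrom_of_lt ω (by omega)]
        exact brickGraph_adj_reflCoord ℓ (hadj i hi)
  · -- injective on `[0, n]`
    simp only [Set.mem_setOf_eq] at hi hj
    have key : ∀ {a b : ℕ}, a ≤ n → b ≤ n → a ≤ p → p < b → unfoldStep n ω a ≠ unfoldStep n ω b := by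
      intro a b ha hb hap hpb heq
      have h1 := unfoldStep_apply_le_maxLevel ω (hp ▸ hap)
      have h2 := maxLevel_lt_unfoldStep_apply ω (hp ▸ hpb) hb
      rw [heq] at h1
      exact absurd (h1.trans_lt h2) (lt_irrefl _)
    by_cases hip : i ≤ p <;> by_cases hjp : j ≤ p
    · rw [unfoldStep, ← hp, ← hℓ, reflectFrom_of_le ω hip, reflectFrom_of_le ω hjp] at hij
      exact hinj hi hj hij
    · exact absurd hij (key hi hj hip (Nat.lt_of_not_le hjp))
    · exact absurd hij.symm (key hj hi hjp (Nat.lt_of_not_le hip))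
    · rw [unfoldStep, ← hp, ← hℓ, reflectFrom_of_lt ω (Nat.lt_of_not_le hip),
        reflectFrom_of_lt ω (Nat.lt_of_not_le hjp)] at hij
      exact hinj hi hj (reflCoord_injective ℓ hij)

/-- The step fixes a walk of `𝕋` iff its height is maximal at the end.
[cite: MadrasSlade1993, §3.1 (proof of Proposition 3.1.5)] -/
theorem unfoldStep_eq_self_iff_brick {n : ℕ} {ω : ℕ → Site 2} (hω : ω ∈ brickSaws n) :
    unfoldStep n ω = ω ↔ lastArgmax n ω = n := by
  obtain ⟨hpn, hpmax⟩ := lastArgmax_spec n ω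
  constructor
  · intro h
    by_contra hne
    have hlt : lastArgmax n ω < n := lt_of_le_of_ne hpn hne
    have := maxLevel_lt_unfoldStep_apply ω hlt le_rfl
    rw [h] at this
    exact absurd (apply_le_maxLevel ω le_rfl) (not_le.2 this)
  · intro h
    funext i
    by_cases hi : i ≤ n
    · exact unfoldStep_of_le ω (h.symm ▸ hi)
    · have hi' : n ≤ i := Nat.le_of_not_le hi
      obtain ⟨-, hend, -, -⟩ := mem_brickSaws.1 hω
      rw [unfoldStep, reflectFrom_of_lt ω (by omega), hend i hi', reflCoord_eq_self_iff]
      have := hpmax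
      rw [h] at this
      exact this

/-! ### Iterating the step: `2n + 1` iterations -/

/-- Iterates of the step stay in `brickSaws n`. [cite: MadrasSlade1993, §3.1 (proof of Proposition 3.1.5)] -/
theorem iterate_unfoldStep_mem_brickSaws {n : ℕ} {ω : ℕ → Site 2} (hω : ω ∈ brickSaws n) (k : ℕ) :
    (unfoldStep n)^[k] ω ∈ brickSaws n := by
  induction k with
  | zero => exact hω
  | succ k ih => rw [Function.iterate_succ_apply']; exact unfoldStep_mem_brickSaws ih

/-- The maximal height of an `n`-step walk of `𝕋` from `0` is between `0` and `2n`.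
[cite: MadrasSlade1993, §3.1] -/
theorem maxLevel_mem_Icc_brick {n : ℕ} {ω : ℕ → Site 2} (hω : ω ∈ brickSaws n) :
    0 ≤ maxLevel n ω ∧ maxLevel n ω ≤ 2 * n := by
  obtain ⟨h0, -, hadj, -⟩ := mem_brickSaws.1 hω
  refine ⟨?_, maxLevel_le fun i hi => ?_⟩
  · have := apply_le_maxLevel ω (Nat.zero_le n)
    rw [h0] at this; simpa using this
  · have := abs_apply_zero_le_of_steps h0 hadj i hi
    have := (abs_le.1 this).2
    omega

/-- A positive increment means the step moves the iterate; then the next increment is smaller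
("`A₁ > A₂ > ⋯`"). [cite: MadrasSlade1993, §3.1 (proof of Proposition 3.1.5)] -/
theorem incr_succ_lt_brick {n : ℕ} {ω : ℕ → Site 2} (hω : ω ∈ brickSaws n) {k : ℕ}
    (h : 0 < incr n ω (k + 1)) : incr n ω (k + 1) < incr n ω k := by
  have hk := iterate_unfoldStep_mem_brickSaws hω k
  have hmove : lastArgmax n ((unfoldStep n)^[k] ω) < n := by
    by_contra hge
    have hfix : unfoldStep n ((unfoldStep n)^[k] ω) = (unfoldStep n)^[k] ω :=
      (unfoldStep_eq_self_iff_brick hk).2 (le_antisymm (lastArgmax_spec _ _).1 (Nat.le_of_not_lt hge))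
    have : incr n ω (k + 1) = 0 := by
      rw [incr, Function.iterate_succ_apply', hfix, increment, hfix, sub_self, Int.toNat_zero]
    omega
  have hlt := increment_unfoldStep_lt hmove
  have hpos : 0 < increment n (unfoldStep n ((unfoldStep n)^[k] ω)) := by
    rw [incr, Function.iterate_succ_apply'] at h
    exact Int.lt_toNat.1 h
  rw [incr, incr, Function.iterate_succ_apply']
  exact (Int.toNat_lt_toNat (hpos.trans hlt)).2 hlt

/-- The increments never increase. [cite: MadrasSlade1993, §3.1 (proof of Proposition 3.1.5)] -/
theorem incr_succ_le_brick {n : ℕ} {ω : ℕ → Site 2} (hω : ω ∈ brickSaws n) (k : ℕ) :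
    incr n ω (k + 1) ≤ incr n ω k := by
  rcases Nat.eq_zero_or_pos (incr n ω (k + 1)) with h | h
  · rw [h]; exact Nat.zero_le _
  · exact (incr_succ_lt_brick hω h).le

/-- **The full unfolding on `𝕋`**: `2n+1` iterations of the step (the maximal height rises at every
effective step, from `≥ 0` to `≤ 2n`). [cite: MadrasSlade1993, §3.1 (proof of Proposition 3.1.5)] -/
def brickUnfold (n : ℕ) (ω : ℕ → Site 2) : ℕ → Site 2 :=
  (unfoldStep n)^[2 * n + 1] ω

/-- **The full unfolding is fixed by the step.**
[cite: MadrasSlade1993, §3.1 (proof of Proposition 3.1.5: "the recursion is stopped at the smallest integer k such that n_k = N")] -/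
theorem unfoldStep_brickUnfold {n : ℕ} {ω : ℕ → Site 2} (hω : ω ∈ brickSaws n) :
    unfoldStep n (brickUnfold n ω) = brickUnfold n ω := by
  by_contra hne
  have hnotfix : ∀ k ≤ 2 * n + 1, unfoldStep n ((unfoldStep n)^[k] ω) ≠ (unfoldStep n)^[k] ω := by
    intro k hk hfix
    apply hne
    rw [brickUnfold, iterate_eq_of_fixed hfix hk, ← Function.iterate_succ_apply' (unfoldStep n) k ω,
      iterate_eq_of_fixed hfix (Nat.le_succ k)]
  have hrise : ∀ k ≤ 2 * n + 1, level n ω 0 + k ≤ level n ω k := by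
    intro k
    induction k with
    | zero => intro _; simp
    | succ k ih =>
      intro hk
      have hk' : k ≤ 2 * n + 1 := (Nat.le_succ k).trans hk
      have hsaws := iterate_unfoldStep_mem_brickSaws hω k
      have hmove : lastArgmax n ((unfoldStep n)^[k] ω) < n := by
        by_contra hge
        exact hnotfix k hk' ((unfoldStep_eq_self_iff_brick hsaws).2
          (le_antisymm (lastArgmax_spec _ _).1 (Nat.le_of_not_lt hge)))
      have hlt := maxLevel_lt_maxLevel_unfoldStep hmove
      have hinc : 1 ≤ (incr n ω k : ℤ) := by
        rw [incr, increment, Int.toNat_of_nonneg (sub_nonneg.2 (maxLevel_le_maxLevel_unfoldStep _ _))]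
        omega
      have := ih hk'
      rw [level_succ]
      push_cast
      omega
  have h1 := hrise (2 * n + 1) le_rfl
  have h2 := (maxLevel_mem_Icc_brick hω).1
  have h3 := (maxLevel_mem_Icc_brick (iterate_unfoldStep_mem_brickSaws hω (2 * n + 1))).2
  have hl0 : level n ω 0 = maxLevel n ω := rfl
  have hl1 : level n ω (2 * n + 1) = maxLevel n ((unfoldStep n)^[2 * n + 1] ω) := rfl
  rw [hl0, hl1] at h1
  push_cast at h1
  omega

/-- The full unfolding is an `n`-step self-avoiding walk of `𝕋`. [cite: MadrasSlade1993, §3.1 (proof of Proposition 3.1.5)] -/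
theorem brickUnfold_mem_brickSaws {n : ℕ} {ω : ℕ → Site 2} (hω : ω ∈ brickSaws n) :
    brickUnfold n ω ∈ brickSaws n :=
  iterate_unfoldStep_mem_brickSaws hω (2 * n + 1)

/-- In the full unfolding the height is maximal at the end. [cite: MadrasSlade1993, §3.1 (proof of Proposition 3.1.5)] -/
theorem apply_le_brickUnfold_last {n : ℕ} {ω : ℕ → Site 2} (hω : ω ∈ brickSaws n) {i : ℕ} (hi : i ≤ n) :
    brickUnfold n ω i 0 ≤ brickUnfold n ω n 0 := by
  have hfix := (unfoldStep_eq_self_iff_brick (brickUnfold_mem_brickSaws hω)).1 (unfoldStep_brickUnfold hω)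
  have h := (lastArgmax_spec n (brickUnfold n ω)).2
  rw [hfix] at h
  rw [h]
  exact apply_le_maxLevel _ hi

/-- **Half-space walks of `𝕋` are unfolded into bridges of `𝕋`.**
[cite: MadrasSlade1993, §3.1 (proof of Proposition 3.1.5)] -/
theorem brickUnfold_mem_brickBridges {n : ℕ} {ω : ℕ → Site 2} (hω : ω ∈ brickHalfSpaceWalks n) :
    brickUnfold n ω ∈ brickBridges n := by
  obtain ⟨hs, hh⟩ := mem_brickHalfSpaceWalks.1 hω
  refine mem_brickBridges.2 ⟨brickUnfold_mem_brickSaws hs, fun i h1 hi => ⟨?_, apply_le_brickUnfold_last hs hi⟩⟩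
  exact isHalfSpace_iterate_unfoldStep hh (2 * n + 1) i h1 hi

/-! ### The code of increments and injectivity -/

/-- **The code of a walk of `𝕋`**: the set of positive increments of the maximal height along the
`2n+1` unfolding steps. [cite: MadrasSlade1993, §3.1 (proof of Proposition 3.1.5)] -/
def brickCode (n : ℕ) (ω : ℕ → Site 2) : Finset ℕ :=
  ((Finset.range (2 * n + 1)).image (incr n ω)).erase 0

/-- Beyond `2n+1` steps the increments vanish. [cite: MadrasSlade1993, §3.1 (proof of Proposition 3.1.5)] -/
theorem incr_eq_zero_of_le_brick {n : ℕ} {ω : ℕ → Site 2} (hω : ω ∈ brickSaws n) {k : ℕ}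
    (hk : 2 * n + 1 ≤ k) : incr n ω k = 0 := by
  have hfix := unfoldStep_brickUnfold hω
  rw [brickUnfold] at hfix
  rw [incr, iterate_eq_of_fixed hfix hk, increment, hfix, sub_self, Int.toNat_zero]

/-- **The code has sum at most `2n`**: the positive increments are distinct (they strictly decrease),
so their sum telescopes to `A₁(final) − A₁(ω) ≤ 2n`.
[cite: MadrasSlade1993, §3.1 (proof of Proposition 3.1.5: "A₁ > A₂ > ⋯ > A_k")] -/
theorem brickCode_mem_finsetsOfSumLE {n : ℕ} {ω : ℕ → Site 2} (hω : ω ∈ brickSaws n) :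
    brickCode n ω ∈ finsetsOfSumLE (2 * n) := by
  rw [mem_finsetsOfSumLE]
  refine ⟨fun s hs => Nat.pos_of_ne_zero (Finset.ne_of_mem_erase hs), ?_⟩
  have hanti : ∀ {a b}, a ≤ b → incr n ω b ≤ incr n ω a := fun {a b} hab => by
    induction hab with
    | refl => exact le_rfl
    | step _ ih => exact (incr_succ_le_brick hω _).trans ih
  have hinj : Set.InjOn (incr n ω) ↑((Finset.range (2 * n + 1)).filter fun k => 0 < incr n ω k) := by
    intro a ha b hb hab
    simp only [Finset.coe_filter, Set.mem_setOf_eq] at ha hb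
    by_contra hne
    rcases lt_or_gt_of_ne hne with h | h
    · have : incr n ω b < incr n ω a := by
        obtain ⟨c, rfl⟩ := Nat.exists_eq_add_of_lt h
        exact (incr_succ_lt_brick hω hb.2).trans_le (hanti (Nat.le_add_right a c))
      omega
    · have : incr n ω a < incr n ω b := by
        obtain ⟨c, rfl⟩ := Nat.exists_eq_add_of_lt h
        exact (incr_succ_lt_brick hω ha.2).trans_le (hanti (Nat.le_add_right b c))
      omega
  have hcode : brickCode n ω =
      ((Finset.range (2 * n + 1)).filter fun k => 0 < incr n ω k).image (incr n ω) := by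
    ext s
    simp only [brickCode, Finset.mem_erase, Finset.mem_image, Finset.mem_filter]
    constructor
    · rintro ⟨hs, k, hk, rfl⟩; exact ⟨k, ⟨hk, Nat.pos_of_ne_zero hs⟩, rfl⟩
    · rintro ⟨k, ⟨hk, hpos⟩, rfl⟩; exact ⟨hpos.ne', k, hk, rfl⟩
  have htel : ∑ k ∈ Finset.range (2 * n + 1), (incr n ω k : ℤ) =
      level n ω (2 * n + 1) - level n ω 0 := by
    rw [← Finset.sum_range_sub (level n ω) (2 * n + 1)]
    exact Finset.sum_congr rfl fun k _ => by rw [level_succ]; ring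
  have hbound : level n ω (2 * n + 1) - level n ω 0 ≤ 2 * n := by
    have h1 := (maxLevel_mem_Icc_brick hω).1
    have h2 := (maxLevel_mem_Icc_brick (iterate_unfoldStep_mem_brickSaws hω (2 * n + 1))).2
    rw [level, level]; simp only [Function.iterate_zero, id_eq]; omega
  calc (brickCode n ω).sum id
      = ∑ k ∈ (Finset.range (2 * n + 1)).filter fun k => 0 < incr n ω k, incr n ω k := by
        rw [hcode, Finset.sum_image hinj]; rfl
    _ ≤ ∑ k ∈ Finset.range (2 * n + 1), incr n ω k :=
        Finset.sum_le_sum_of_subset_of_nonneg (Finset.filter_subset _ _) fun _ _ _ => Nat.zero_le _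
    _ ≤ 2 * n := by exact_mod_cast htel ▸ hbound

/-- Walks of `𝕋` with the same code have the same increments.
[cite: MadrasSlade1993, §3.1 (proof of Proposition 3.1.5)] -/
theorem incr_eq_of_brickCode_eq {n : ℕ} {ω ω' : ℕ → Site 2} (hω : ω ∈ brickSaws n)
    (hω' : ω' ∈ brickSaws n) (h : brickCode n ω = brickCode n ω') : incr n ω = incr n ω' :=
  eq_of_antitone_of_image_eq (incr_succ_le_brick hω) (fun _ => incr_succ_lt_brick hω)
    (fun _ hk => incr_eq_zero_of_le_brick hω hk) (incr_succ_le_brick hω')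
    (fun _ => incr_succ_lt_brick hω') (fun _ hk => incr_eq_zero_of_le_brick hω' hk) h

/-- **`ω ↦ (brickUnfold ω, brickCode ω)` is injective on the `n`-step self-avoiding walks of `𝕋`.**
[cite: MadrasSlade1993, §3.1 (proof of Proposition 3.1.5: "this transformation is one-to-one")] -/
theorem brickUnfold_code_injOn (n : ℕ) :
    Set.InjOn (fun ω : ℕ → Site 2 => (brickUnfold n ω, brickCode n ω)) ↑(brickSaws n) := by
  intro ω hω ω' hω' h
  simp only [Prod.mk.injEq] at h
  obtain ⟨hU, hC⟩ := h
  have hω₁ : ω ∈ brickSaws n := hω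
  have hω₂ : ω' ∈ brickSaws n := hω'
  have hincr := incr_eq_of_brickCode_eq hω₁ hω₂ hC
  have hsum : ∀ (ξ : ℕ → Site 2) (k m : ℕ), k ≤ m →
      level n ξ m = level n ξ k + ∑ i ∈ Finset.Ico k m, (incr n ξ i : ℤ) := by
    intro ξ k m hkm
    induction m, hkm using Nat.le_induction with
    | base => simp
    | succ m hkm ih => rw [level_succ, ih, Finset.sum_Ico_succ_top hkm]; ring
  have hfin : level n ω (2 * n + 1) = level n ω' (2 * n + 1) := congrArg (maxLevel n) hU
  have hlev : ∀ k ≤ 2 * n + 1, level n ω k = level n ω' k := fun k hk => by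
    have e1 := hsum ω k (2 * n + 1) hk
    have e2 := hsum ω' k (2 * n + 1) hk
    rw [hincr] at e1
    linarith
  have hit : ∀ j ≤ 2 * n + 1,
      (unfoldStep n)^[2 * n + 1 - j] ω = (unfoldStep n)^[2 * n + 1 - j] ω' := by
    intro j hj
    induction j with
    | zero => exact hU
    | succ j ih =>
      have ih' := ih (Nat.le_of_succ_le hj)
      have hk1 : 2 * n + 1 - j = (2 * n + 1 - (j + 1)) + 1 := by omega
      rw [hk1] at ih'
      have e : ∀ ξ : ℕ → Site 2, (unfoldStep n)^[2 * n + 1 - (j + 1)] ξ =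
          undoStep n ((unfoldStep n)^[2 * n + 1 - (j + 1) + 1] ξ) (level n ξ (2 * n + 1 - (j + 1))) :=
        fun ξ => by rw [Function.iterate_succ_apply', level, undoStep_unfoldStep]
      rw [e ω, e ω', ih', hlev _ (by omega)]
  have := hit (2 * n + 1) le_rfl
  simpa using this

/-! ### Counting: `#T ≤ e^{3√(2n)} · #(unfold '' T)` and `h_n ≤ e^{3√(2n)} b_n` -/

open Classical in
/-- For every set `T` of `n`-step self-avoiding walks of `𝕋`, `#T ≤ #{codes} · #(brickUnfold '' T)`.
[cite: MadrasSlade1993, §3.1 (proof of Proposition 3.1.5, (3.1.4))] -/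
theorem card_le_card_codes_mul_card_image_brickUnfold {n : ℕ} {T : Finset (ℕ → Site 2)}
    (hT : T ⊆ brickSaws n) :
    T.card ≤ (finsetsOfSumLE (2 * n)).card * (T.image (brickUnfold n)).card := by
  calc T.card ≤ ((T.image (brickUnfold n)) ×ˢ finsetsOfSumLE (2 * n)).card := by
        refine Finset.card_le_card_of_injOn (fun ω => (brickUnfold n ω, brickCode n ω)) (fun ω hω => ?_)
          fun ω hω ω' hω' h => brickUnfold_code_injOn n (hT hω) (hT hω') h
        exact Finset.mem_product.2 ⟨Finset.mem_image_of_mem _ hω, brickCode_mem_finsetsOfSumLE (hT hω)⟩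
    _ = (finsetsOfSumLE (2 * n)).card * (T.image (brickUnfold n)).card := by
        rw [Finset.card_product, mul_comm]

open Classical in
/-- **`#T ≤ e^{3√(2n)} · #(brickUnfold '' T)`** for every set `T` of `n`-step self-avoiding walks of `𝕋`.
[cite: MadrasSlade1993, §3.1 (proof of Proposition 3.1.5, (3.1.4)–(3.1.5))] -/
theorem card_le_exp_mul_card_image_brickUnfold {n : ℕ} {T : Finset (ℕ → Site 2)}
    (hT : T ⊆ brickSaws n) :
    (T.card : ℝ) ≤ Real.exp (3 * Real.sqrt (2 * n)) * (T.image (brickUnfold n)).card := by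
  have h := card_le_card_codes_mul_card_image_brickUnfold hT
  have h' : (T.card : ℝ) ≤ ((finsetsOfSumLE (2 * n)).card : ℝ) * (T.image (brickUnfold n)).card := by
    exact_mod_cast h
  have hc := card_finsetsOfSumLE_le_exp (2 * n)
  push_cast at hc
  exact h'.trans (mul_le_mul_of_nonneg_right hc (Nat.cast_nonneg _))

/-- **Madras–Slade Proposition 3.1.5 on `𝕋`, explicit form: `h_n(𝕋) ≤ e^{3√(2n)} b_n(𝕋)`** — half-space
walks unfold into bridges, at most `e^{3√(2n)}`-to-one. [cite: MadrasSlade1993, Proposition 3.1.5] -/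
theorem brickHalfSpaceCount_le_exp_mul_brickBridgeCount (n : ℕ) :
    (brickHalfSpaceCount n : ℝ) ≤ Real.exp (3 * Real.sqrt (2 * n)) * brickBridgeCount n := by
  classical
  have hT : brickHalfSpaceWalks n ⊆ brickSaws n := fun ω hω => (mem_brickHalfSpaceWalks.1 hω).1
  have himg : (brickHalfSpaceWalks n).image (brickUnfold n) ⊆ brickBridges n := by
    intro ξ hξ
    obtain ⟨ω, hω, rfl⟩ := Finset.mem_image.1 hξ
    exact brickUnfold_mem_brickBridges hω
  calc (brickHalfSpaceCount n : ℝ) = ((brickHalfSpaceWalks n).card : ℝ) := rfl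
    _ ≤ Real.exp (3 * Real.sqrt (2 * n)) * ((brickHalfSpaceWalks n).image (brickUnfold n)).card :=
        card_le_exp_mul_card_image_brickUnfold hT
    _ ≤ Real.exp (3 * Real.sqrt (2 * n)) * brickBridgeCount n := by
        refine mul_le_mul_of_nonneg_left ?_ (Real.exp_nonneg _)
        exact_mod_cast Finset.card_le_card himg

end Literature.Probability.RandomPlanarGeometry.SAW
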